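/-
Copyright (c) 2026 the pub-hodgecm-mathlib formalisation cell (harness21).  Prover seat hodgecm-mathlib-LH4-p18 (g4), req620 Track A «(D-RAM) FOUR-FRAME» squad
(STAGE-1b, row (2) of the piece `f_{T₊}`, the (β₂) road (R-36) «PURE-CELL LEDGER»; β₂ sub-dealer LH4-p04 (g10) WORD #37 «p18: ‹FLIPT.v1› PAYER», K6 desk LH4-p16 (g3)
WORDS #1 (c), #2 (α) «‹FLIPVAL› =», #10, #11 «THE K6 FLOOR `(N) (hN : ∀ d tE q, 4·d ≤ N d tE q)`»; F2b = THE ‹FLIPVAL.letter.v1› PAYER), 2026-09-05.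
-/
import Summits.HodgeConjecture.HodgeConjecture.Theorems.F0P3cDyRamRowTowerCellPerCellValue   -- ★ F1b p864627 (this seat): `rowTower_cellDiff_mul_card_eq` (★ K6-0 HEAD′ on a row tower cell); brings ★ F1a, the socket reads, the MASTER's vocabulary
import Summits.HodgeConjecture.HodgeConjecture.Theorems.F0P3cDyRamFlipCellDigitReads         -- ★ F2a (this seat): `classClause_iff_of_units_far`, `card_unitDigits_and_sum_normSign_affine`; brings ★ p864361's shell dictionary
import Summits.HodgeConjecture.HodgeConjecture.Theorems.F0P3cDyRamRamKFrameClassLetters       -- ★ (LH4-p19 (g3)): `fgap_of_datum`, `deep_of_datum`, `dich_of_datum`, `exists_flipWitness_of_frame`, `exists_refPair_of_frame`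
import Summits.HodgeConjecture.HodgeConjecture.Theorems.F0P3cDyRamDiagonalCellAffineLabel     -- ★ p862927 (LH4-p16 (g2)): `exists_affineLabel_of_coords` (the label dictionary `(α₁, γ₁, haff)`)
import HarnessLib

/-!
# Crux `H413`, line LH4 «(D-RAM) FOUR-FRAME» — STAGE-1b, row (2), the (β₂) road (R-36), K6 road F2b: «‹FLIPVAL› — THE FLIP CELL IS ANTI-PURE PER CAPITA WITH THE ROW'S BIT»,
# paid from ★ F1b under the K6 floor `4·d ≤ N d tE q`

Cell `hodgecm-mathlib` (D-0151), FLOOR 0, crux item H413 = `stmt-HodgeConjecture-24833`, route of record `HCCMUnconditional`; squad F0∕P3c∕LH4; lane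
`--supports stmt-HodgeConjecture-24833 --as helper` (count-neutral; pays NO tier-0 row).  THEOREMS ONLY (no `def`, no instance, no notation, no `sorry`, default heartbeats);
★-only imports; states NO law; (β₂) stays a HYPOTHESIS.
WHAT.  `flipval_of_rowTower (N : ℕ → ℕ → ℕ → ℕ) (hN : ∀ d tE q, 4 * d ≤ N d tE q) : ‹FLIPVAL.letter.v1›[N]` — the letter VERBATIM (this seat's HOME
`FLIPVAL.letter.v1.LH4p18g4.lean.txt` sha16 5715f3c442a3f2b0 = the binder `hflipval` of ★ p864398 `…FliptOfFlipCellValue.flipt_of_flipval (N)`): the ‹FLIPT.letter.v1› ∕ ‹HFT.letter.v2›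
block, the cell quantifiers `1 ≤ b`, `2b = m`, `d = 2`, `tE < m`, `4 ≤ m`, an `h`-isotropic vector, `b + c = j`, `2d ≤ c`, `j + b + 2 = jl`, and for every `σ`-fixed unit `fE` with the
row's clean `M`-letter `|lam − jE u₀₀ + jE(fE·t₊·(ϖσϖ)^b)| ≤ |jEϖ|^{2b + m⋆}`: **`(q − 1)·X(j,b) = −((fE·h_W ∈ N(E^×) ? 1 : −1)·n(j,b))`**.  Under the K6 floor (K6 desk WORD #11, the
pattern of ★ `rowOdd_of_coreOdd (N) (hN)`): `m ≥ N 2 tE q ≥ 8`, so `b ≥ 4 = 2d` — exactly ★ F1b's sharp precision floor at the flip cell with digits modulo `|ϖ|^4`.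
MECHANISM (no new law).  (1) `c` is even (★ `antiDepth_mod_two_eq`: `jl ≡ d ≡ 0`), the chart `(κ₀, ξ₀)` with `|ξ₀| = exp c` is ★ LH4-p19 `exists_refPair_of_frame` (so the flip
cell is the TOP INSIDE cell, `g = 1`, digits `|V| = 1`); the class letters are ★ LH4-p19 `fgap_of_datum ∕ deep_of_datum ∕ dich_of_datum ∕ exists_flipWitness_of_frame`; the
`(1, α)`-coordinates `(μ_a, μ_b)` of `μ = lam − jE u₀₀`, `R₀`, `γ₀` are read through `Fix ρ = jE(E)`; the dictionary `(α₁, γ₁, haff)` is ★ p862927 at `g = 1` (`|γ₁| = |ϖ|²`);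
the digit system `Rd` (fixed integral, modulo `|ϖ|^4`) is ★ `exists_repr_fixedBall_card`.  (2) ★ F1b p864627 gives `X(j,b)·#(Rd.filter LIT) = n(j,b)·(ω(−h_W)·Σ_{Rd.filter LIT} ω(α₁ + γ₁V))`.
(3) If `Rd.filter LIT = ∅` the cell is EMPTY ((hV) ★ p863914 + `hRd2` + (hLit) ★ p863983 put the digit of any member in `Rd.filter LIT`), and the letter reads `0 = 0`; otherwise
`Rd.filter LIT = Rd.filter (|·| = 1)` (sphere ↔ unit by ★ p864361 `sphereClause_iff_v_eq_one_of_lt`; the class conjunct is constant on the unit shell by ★ F2a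
`classClause_iff_of_units_far`, `1 ≤ |jEϖ|^3·|ξ₀|` as `c ≥ 4`), and ★ F2a `card_unitDigits_and_sum_normSign_affine` evaluates `#… = (q−1)·q`, `Σ… = −q·ω(α₁)`; cancelling `q`
gives `(q − 1)·X = −ω(−h_W)·ω(α₁)·n`.  (4) SIGN RECONCILIATION: `haff` at `(T, V, f) := (1, 0, −fE)` — admissible because `|μ_b|·|jE R₀ − α| ≤ exp(−jl) < |jEϖ|^{2b + m⋆}` turns the
row's clean letter into `|â + fE·t₊| ≤ |ϖ|^{m⋆}` — gives `ω(α₁) = ω(−fE)`, and `ω(−h_W)·ω(−fE) = ω(fE·h_W)` (★ Lit `normSign_mul_of_fixed`) is the letter's `if`.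
WHAT IS NOT CLAIMED: ‹FLIPT› (that is ★ p864398 ∘ this), ‹CORE-3›, any value on the rows below the floor; β₂ `stub_law_cleanSgn₂` stays OPEN.
HONEST LABEL.  Count-neutral assembly of ★ pieces; nothing printed is asserted; no census law is stated; `HC_CM` is proved only modulo the 7 printed citations (2 remaining named inputs:
hLiu418 = `stmt-HodgeConjecture-24832`, h413 = `stmt-HodgeConjecture-24833`) until rung 0 closes.
## References
* [Kottwitz1986BaseChangeUnits] R. E. Kottwitz, *Base change for unit elements of Hecke algebras*, Compositio Math. 60 (1986): §1 pp. 240–241 (signed lattice counts cell by cell).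
* [LabesseLanglands1979] J.-P. Labesse, R. P. Langlands, *L-indistinguishability for SL(2)*, Canad. J. Math. 31 (1979): §2 (2.2) p. 9 (κ-signed counts).
* [Rogawski1990] J. D. Rogawski, *Automorphic Representations of Unitary Groups in Three Variables*, Ann. of Math. Stud. 123 (1990): §4.9 Prop. 4.9.1 (b) p. 55.
* [Serre1979] J.-P. Serre, *Local Fields*, GTM 67 (1979): Ch. V §3 Prop. 5, Cor. 2–3 pp. 84–87; Ch. XV §2.
-/

set_option autoImplicit false

noncomputable section

namespace Summit.HodgeConjecture.HodgeConjecture.Cruxes.H413.F0P3cDyRamFlipvalOfRowTowerCell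

open scoped Valued WithZero Matrix MatrixGroups Classical
open WithZero Finset
open Literature.NumberTheory.Automorphic Literature.NumberTheory.Automorphic.HermitianLattice Literature.NumberTheory.Automorphic.UnitaryLatticeTree
open Literature.NumberTheory.Automorphic.UnitaryThreeFourFrame (IsRamifiedQuadraticDatum normSign normSign_of_isNorm)
open Literature.NumberTheory.LocalFields.WildQuadraticDatum (normSign_mul_of_fixed)
open Literature.NumberTheory.Rogawski1990
open Summit.HodgeConjecture.HodgeConjecture.Cruxes.H413.F0P3cDyRamFourFramePieces
open Summit.HodgeConjecture.HodgeConjecture.Cruxes.H413.F0P3cDyRamFourFrameCensusDefs (LatticeInLevel LatticeNearTransvShell)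
open Summit.HodgeConjecture.HodgeConjecture.Cruxes.H413.F0P3cDyRamStageOneBDefs (mcOfRecord)
open Summit.HodgeConjecture.HodgeConjecture.Cruxes.H413.F0P3cDyRamToricCensusDefs
open Summit.HodgeConjecture.HodgeConjecture.Cruxes.H413.F0P3cDyRamRowCellOnShell (uniformizer_letters)
open Summit.HodgeConjecture.HodgeConjecture.Cruxes.H413.F0P3cDyRamRowCleanCellBit (antiDepth_mod_two_eq)
open Summit.HodgeConjecture.HodgeConjecture.Cruxes.H413.F0P3cDyRamDatumParity (d_le_t_of_even)
open Summit.HodgeConjecture.HodgeConjecture.Cruxes.H413.F0P3cDyRamRowTowerCellPerCellValue (rowTower_cellDiff_mul_card_eq)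
open Summit.HodgeConjecture.HodgeConjecture.Cruxes.H413.F0P3cDyRamFlipCellDigitReads (classClause_iff_of_units_far card_unitDigits_and_sum_normSign_affine)
open Summit.HodgeConjecture.HodgeConjecture.Cruxes.H413.F0P3cDyRamRamKFrameClassLetters (fgap_of_datum deep_of_datum dich_of_datum exists_flipWitness_of_frame exists_refPair_of_frame)
open Summit.HodgeConjecture.HodgeConjecture.Cruxes.H413.F0P3cDyRamDiagonalCellAffineLabel (exists_affineLabel_of_coords)
open Summit.HodgeConjecture.HodgeConjecture.Cruxes.H413.F0P3cDyRamDiagonalFixedClassSystems (exists_repr_fixedBall_card)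
open Summit.HodgeConjecture.HodgeConjecture.Cruxes.H413.F0P3cDyRamRowCellDigitShellDictionary (radius_letters sphereClause_iff_v_eq_one_of_lt)
open Summit.HodgeConjecture.HodgeConjecture.Cruxes.H413.F0P3cDyRamRowCellSocketReads (exists_coord_of_gen)
open Summit.HodgeConjecture.HodgeConjecture.Cruxes.H413.F0P3cDyRamRowCellSocketLit (lit_of_near_of_gen)
open Summit.HodgeConjecture.HodgeConjecture.Cruxes.H413.F0P3cDyRamConeCellLedgerSizes (levelSetDep_eq_levelSet_of_add_le)

/-- **HEAD — ‹FLIPVAL.letter.v1› UNDER THE K6 FLOOR.**  For every fence function `N` with `4·d ≤ N d tE q`: the letter ‹FLIPVAL.letter.v1› VERBATIM (module docstring) —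
on the flip cell `j + b + 2 = jl` of the live row `2b = m` at `d = 2`, for every `σ`-fixed unit `fE` carrying the row's clean `M`-letter,
`(q − 1)·X(j,b) = −((∃ z, z·σz = fE·h_W) ? 1 : −1)·n(j,b)`.  Proof = ★ F1b at the chart of ★ LH4-p19 + ★ F2a's two digit reads + ★ p862927's dictionary + the sign reconciliation.
[cite: Kottwitz1986BaseChangeUnits, §1 pp. 240–241] [cite: LabesseLanglands1979, §2 (2.2) p. 9] [cite: Rogawski1990, §4.9 Prop. 4.9.1 (b) p. 55] [cite: Serre1979, Ch. V §3 Cor. 3; Ch. XV §2] -/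
theorem flipval_of_rowTower (N : ℕ → ℕ → ℕ → ℕ) (hN : ∀ d tE q, 4 * d ≤ N d tE q) :
    ∀ (E M : Type) [Field E] [Valued E ℤᵐ⁰] [CompleteSpace E] [IsDiscreteValuationRing 𝒪[E]] [Finite 𝓀[E]]
      [Field M] [Valued M ℤᵐ⁰] [CompleteSpace M] [IsDiscreteValuationRing 𝒪[M]] [Finite 𝓀[M]]
      (σ : E →+* E) (ϖ : E) (d tE : ℕ) (_hD : IsRamifiedQuadraticDatum σ ϖ d tE) (_hσσ : ∀ a, σ (σ a) = a) (_h2 : ¬ IsUnit (2 : 𝒪[E]))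
      (jE : E →+* M) (ρ Θ : M →+* M) (α lam : M)
      (_hρρ : ∀ z, ρ (ρ z) = z) (_hvρ : ∀ z, Valued.v (ρ z) = Valued.v z) (_hρj : ∀ a, ρ (jE a) = jE a)
      (_hjv : ∀ a, Valued.v (jE a) ≤ 1 ↔ Valued.v a ≤ 1) (_hjfix : ∀ z : M, ρ z = z ↔ ∃ a, jE a = z) (_hΘj : ∀ a, Θ (jE a) = jE (σ a))
      (_hΘΘ : ∀ z, Θ (Θ z) = z) (_hΘρ : ∀ z, Θ (ρ z) = ρ (Θ z)) (_hvΘ : ∀ z, Valued.v (Θ z) = Valued.v z)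
      (_hα : ρ α ≠ α) (_hα1 : Valued.v α ≤ 1) (_hint : ∀ z : M, Valued.v z ≤ 1 → Valued.v ((z - ρ z) / (α - ρ α)) ≤ 1)
      (_hΘlam : Θ lam * lam = 1) (_hvlam : Valued.v lam = 1) (_hbasis : ∀ z : M, ∃! pq : E × E, z = jE pq.1 + jE pq.2 * lam)
      (_hU : Valued.v (α - ρ α) = 1) (_hτ : Valued.v (α - Θ α) < 1)
      (_hσres : ∀ z : M, ρ z = z → Valued.v z ≤ 1 → Valued.v (Θ z - z) < 1) (_hres : ∀ z : M, Valued.v z ≤ 1 → Valued.v (z - Θ z) < 1)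
      (_hΘne : ∃ x : M, Θ x ≠ x) (_hDM : IsRamifiedQuadraticDatum Θ (jE ϖ) d tE) (_hjiso : ∀ a, Valued.v (jE a) = Valued.v a)
      (_hq : Nat.card 𝓀[M] = Nat.card 𝓀[E] ^ 2) (_hjpow : ∀ (t : E) (n : ℤ), Valued.v (jE t) = Valued.v (jE ϖ) ^ n ↔ Valued.v t = Valued.v ϖ ^ n)
      (_hEval : ∀ c : M, ρ c = c → c ≠ 0 → Valued.v c ≤ 1 → ∃ n : ℕ, Valued.v c = Valued.v (jE ϖ) ^ n)
      (_hϖmax : ∀ t : M, ρ t = t → Valued.v t < 1 → Valued.v t ≤ Valued.v (jE ϖ))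
      (γ₂ : GL (Fin 2) E) (u : GL (Fin 1) E)
      (_hdet : (γ₂ : Matrix (Fin 2) (Fin 2) E).det * σ (γ₂ : Matrix (Fin 2) (Fin 2) E).det = 1)
      (_htr : (γ₂ : Matrix (Fin 2) (Fin 2) E).trace = (γ₂ : Matrix (Fin 2) (Fin 2) E).det * σ (γ₂ : Matrix (Fin 2) (Fin 2) E).trace)
      (_hirr : ∀ x : E, x * x - (γ₂ : Matrix (Fin 2) (Fin 2) E).trace * x + (γ₂ : Matrix (Fin 2) (Fin 2) E).det ≠ 0)
      (_hlam2 : lam * lam = jE (γ₂ : Matrix (Fin 2) (Fin 2) E).trace * lam - jE (γ₂ : Matrix (Fin 2) (Fin 2) E).det)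
      (_hρlam : ρ lam = jE (γ₂ : Matrix (Fin 2) (Fin 2) E).trace - lam) (m jl : ℕ) (_hm : Valued.v (lam - jE ((u : Matrix (Fin 1) (Fin 1) E) 0 0)) = WithZero.exp (-(m : ℤ)))
      (_hjl : Valued.v ((lam - jE ((u : Matrix (Fin 1) (Fin 1) E) 0 0)) - ρ (lam - jE ((u : Matrix (Fin 1) (Fin 1) E) 0 0))) = WithZero.exp (-(jl : ℤ)))
      (_hs : Valued.v ((γ₂ : Matrix (Fin 2) (Fin 2) E).trace - 2) * Valued.v (ϖ ^ (d % 2)) ≤ Valued.v (ϖ ^ mcOfRecord d))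
      (_hp : Valued.v ((γ₂ : Matrix (Fin 2) (Fin 2) E).det - (γ₂ : Matrix (Fin 2) (Fin 2) E).trace + 1) ≤ Valued.v (ϖ ^ mcOfRecord d))
      (_hNm : N d tE (Nat.card 𝓀[E]) ≤ m) (_hu1N : Valued.v (((u : Matrix (Fin 1) (Fin 1) E) 0 0) - 1) ≤ Valued.v (ϖ ^ N d tE (Nat.card 𝓀[E]))) (_hlam1 : Valued.v (lam - 1) ≤ Valued.v (jE ϖ ^ N d tE (Nat.card 𝓀[E])))
      (_hu : Valued.v ((u : Matrix (Fin 1) (Fin 1) E) 0 0) = 1) (_hum : Valued.v (((u : Matrix (Fin 1) (Fin 1) E) 0 0) - 1) ≤ Valued.v (ϖ ^ mstarOfRecord d))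
      (H₂ : Matrix (Fin 2) (Fin 2) E) (hW : E) (_hH₂ : IsUnit H₂.det) (_hH₂σ : (H₂.map σ)ᵀ = H₂) (_hhW : Valued.v hW = 1) (_hhWσ : σ hW = hW)
      (P₁ : GL (Fin 3) E) (_hA : formCongr σ P₁ ((StdForm.antidiagonal 3).over E) = (!![H₂ 0 0, 0, H₂ 0 1; 0, hW, 0; H₂ 1 0, 0, H₂ 1 1] : Matrix (Fin 3) (Fin 3) E))
      (_hΓ : P₁ * endoGL (γ₂, u) * P₁⁻¹ ∈ unitaryGroupOfForm σ ((StdForm.antidiagonal 3).over E))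
      (φ : (Fin 2 → E) →+ M) (h : M) (_hφs : ∀ (c : E) (x : Fin 2 → E), φ (c • x) = jE c * φ x) (_hφi : Function.Injective φ) (_hφo : Function.Surjective φ)
      (_hφγ : ∀ x, φ ((γ₂ : Matrix (Fin 2) (Fin 2) E).mulVec x) = lam * φ x)
      (_hform : ∀ x y, jE (pairing σ H₂ x y) = h * Θ (φ x) * φ y + ρ (h * Θ (φ x) * φ y)) (_hΘh : Θ h = h) (_hh : h ≠ 0)
      (J R : ℕ) (f : ℕ → ℕ → AddSubgroup M → ℕ)
      (_hfinF : {L₃ : Submodule 𝒪[E] (Fin 3 → E) | IsSelfDualLattice σ ϖ (!![H₂ 0 0, 0, H₂ 0 1; 0, hW, 0; H₂ 1 0, 0, H₂ 1 1] : Matrix (Fin 3) (Fin 3) E) L₃ ∧ mapGL (endoGL (γ₂, u)) L₃ = L₃}.Finite)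
      (_hR : ∀ L₃ : Submodule 𝒪[E] (Fin 3 → E), IsSelfDualLattice σ ϖ (!![H₂ 0 0, 0, H₂ 0 1; 0, hW, 0; H₂ 1 0, 0, H₂ 1 1] : Matrix (Fin 3) (Fin 3) E) L₃ →
        mapGL (endoGL (γ₂, u)) L₃ = L₃ → ∀ b : ℕ, (∀ c : E, (Pi.single 1 c : Fin 3 → E) ∈ L₃ ↔ Valued.v c ≤ Valued.v ϖ ^ b) → b ≤ R)
      (_hJ : ¬ IsOrd ρ α (jE ϖ ^ (J + 1)) lam) (_hfinLS : ∀ j a, (levelSet ρ Θ α (jE ϖ) h j a).Finite)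
      (_hf : ∀ (b j : ℕ) (Λ : AddSubgroup M) (x₀ : M) (r : E), 1 ≤ b → x₀ ≠ 0 → (∀ x, x ∈ Λ ↔ ∃ z, IsOrd ρ α (jE ϖ ^ j) z ∧ x = x₀ * z) →
        IsOrd ρ α (jE ϖ ^ j) (dualGen ρ Θ α (jE ϖ ^ j) h x₀) → ¬ IsOrd ρ α (jE ϖ ^ j) (dualGen ρ Θ α (jE ϖ ^ j) h x₀ / jE ϖ) → Valued.v (dualGen ρ Θ α (jE ϖ ^ j) h x₀) = Valued.v (jE ϖ) ^ b →
        (∀ b', (∀ x ∈ Λ, Valued.v (h * Θ x * b' + ρ (h * Θ x * b')) ≤ 1) → (lam - jE ((u : Matrix (Fin 1) (Fin 1) E) 0 0)) * b' ∈ Λ) → IsOrd ρ α (jE ϖ ^ j) lam →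
        jE r = glueUnit ρ Θ α (jE ϖ ^ j) h (jE ϖ) (jE hW) x₀ b →
        f b j Λ = Nat.card {x : 𝒪[E] ⧸ 𝓂[E] ^ (2 * b) // ∃ u' : 𝒪[E], Ideal.Quotient.mk (𝓂[E] ^ (2 * b)) u' = x ∧ Valued.v ((u' : E) * σ u' - r) ≤ Valued.v (ϖ ^ (2 * b))}),
      ∀ b : ℕ, 1 ≤ b → 2 * b = m → d = 2 → tE < m → 4 ≤ m → (∃ x : M, x ≠ 0 ∧ h * Θ x * x + ρ (h * Θ x * x) = 0) →
        ∀ j c : ℕ, b + c = j → 2 * d ≤ c → j + b + 2 = jl →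
        ∀ fE : E, σ fE = fE → Valued.v fE = 1 →
          Valued.v (lam - jE ((u : Matrix (Fin 1) (Fin 1) E) 0 0) + jE (fE * ((ϖ - σ ϖ) * ((ϖ * σ ϖ) ^ ((d - d % 2) / 2))⁻¹) * (ϖ * σ ϖ) ^ b)) ≤
            Valued.v (jE ϖ) ^ (2 * b + mstarOfRecord d) →
          ((Nat.card 𝓀[E] : ℤ) - 1) *
          (((∑ᶠ Λ ∈ levelSetDep ρ Θ α (jE ϖ) h j b (lam - jE ((u : Matrix (Fin 1) (Fin 1) E) 0 0)) ∩
                    {Λ | ∃ B : Submodule 𝒪[E] (Fin 2 → E), B.toAddSubgroup.map φ = Λ ∧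
                      ∃ L₃ : Submodule 𝒪[E] (Fin 3 → E), IsSelfDualLattice σ ϖ (!![H₂ 0 0, 0, H₂ 0 1; 0, hW, 0; H₂ 1 0, 0, H₂ 1 1] : Matrix (Fin 3) (Fin 3) E) L₃ ∧
                        L₃ ⊓ LinearMap.ker ((LinearMap.proj (1 : Fin 3) : (Fin 3 → E) →ₗ[E] E).restrictScalars 𝒪[E]) =
                          B.map ((Matrix.toLin' (!![1, 0; 0, 0; 0, 1] : Matrix (Fin 3) (Fin 2) E)).restrictScalars 𝒪[E]) ∧
                        (∀ c : E, (Pi.single 1 c : Fin 3 → E) ∈ L₃ ↔ Valued.v c ≤ Valued.v ϖ ^ b) ∧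
                        (LatticeNearTransvShell ϖ (d % 2) (mstarOfRecord d) ((((endoGL (γ₂, u) : GL (Fin 3) E) : Matrix (Fin 3) (Fin 3) E) - 1)) L₃ ∧
                          {z : E | ∃ y ∈ L₃, Valued.v ((ϖ ^ (mstarOfRecord d))⁻¹ * (z - pairing σ (!![H₂ 0 0, 0, H₂ 0 1; 0, hW, 0; H₂ 1 0, 0, H₂ 1 1] : Matrix (Fin 3) (Fin 3) E) y (((((endoGL (γ₂, u) : GL (Fin 3) E) : Matrix (Fin 3) (Fin 3) E) - 1)) *ᵥ y))) ≤ 1} =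
                            valueSetMod σ ϖ (mstarOfRecord d) (xPlus σ ϖ d))}, f b j Λ : ℕ) : ℤ) -
                ((∑ᶠ Λ ∈ levelSetDep ρ Θ α (jE ϖ) h j b (lam - jE ((u : Matrix (Fin 1) (Fin 1) E) 0 0)) ∩
                    {Λ | ∃ B : Submodule 𝒪[E] (Fin 2 → E), B.toAddSubgroup.map φ = Λ ∧
                      ∃ L₃ : Submodule 𝒪[E] (Fin 3 → E), IsSelfDualLattice σ ϖ (!![H₂ 0 0, 0, H₂ 0 1; 0, hW, 0; H₂ 1 0, 0, H₂ 1 1] : Matrix (Fin 3) (Fin 3) E) L₃ ∧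
                        L₃ ⊓ LinearMap.ker ((LinearMap.proj (1 : Fin 3) : (Fin 3 → E) →ₗ[E] E).restrictScalars 𝒪[E]) =
                          B.map ((Matrix.toLin' (!![1, 0; 0, 0; 0, 1] : Matrix (Fin 3) (Fin 2) E)).restrictScalars 𝒪[E]) ∧
                        (∀ c : E, (Pi.single 1 c : Fin 3 → E) ∈ L₃ ↔ Valued.v c ≤ Valued.v ϖ ^ b) ∧
                        (LatticeNearTransvShell ϖ (d % 2) (mcOfRecord d) ((((endoGL (γ₂, u) : GL (Fin 3) E) : Matrix (Fin 3) (Fin 3) E) - 1)) L₃ ∧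
                          ¬ {z : E | ∃ y ∈ L₃, Valued.v ((ϖ ^ (mstarOfRecord d))⁻¹ * (z - pairing σ (!![H₂ 0 0, 0, H₂ 0 1; 0, hW, 0; H₂ 1 0, 0, H₂ 1 1] : Matrix (Fin 3) (Fin 3) E) y (((((endoGL (γ₂, u) : GL (Fin 3) E) : Matrix (Fin 3) (Fin 3) E) - 1)) *ᵥ y))) ≤ 1} =
                            valueSetMod σ ϖ (mstarOfRecord d) (xPlus σ ϖ d))}, f b j Λ : ℕ) : ℤ)) =
          -((if ∃ z : E, z * σ z = fE * hW then (1 : ℤ) else -1) *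
            ((∑ᶠ Λ ∈ levelSetDep ρ Θ α (jE ϖ) h j b (lam - jE ((u : Matrix (Fin 1) (Fin 1) E) 0 0)), f b j Λ : ℕ) : ℤ)) := by
  intro E M _ _ _ _ _ _ _ _ _ _ σ ϖ d tE hD _hσσ _h2 jE ρ Θ α lam hρρ hvρ hρj hjv hjfix hΘj hΘΘ hΘρ hvΘ hα hα1 hint hΘlam hvlam _hbasis hU hτ hσres
    _hres _hΘne hDM hjiso hq hjpow _hEval hϖmax γ₂ u _hdet _htr _hirr _hlam2 _hρlam m jl hm hjl _hs _hp hNm hu1N hlam1 _hu hum H₂ hW hH₂ hH₂σ hhW hhWσ P₁ hA hΓ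
    φ h hφs hφi hφo hφγ hform hΘh hh _J _R f _hfinF _hR _hJ hfinLS hf b hb1 hb2 hd2 htm _h4m _hiso j c hbc hdc hjbl fE hfE hfE1 hμf
  subst hd2
  obtain ⟨hσσ, hvσ, hϖ, hfix, hdϖ, -, h2t⟩ := id hD
  obtain ⟨hϖ0, hϖlt, hjϖ0, hvjϖ0, hvjϖpos, hjϖlt, hjϖle⟩ := uniformizer_letters jE hjv hϖ
  have hϖ1 : Valued.v ϖ ≤ 1 := hϖlt.le
  have hvϖ0 : Valued.v ϖ ≠ 0 := (Valuation.ne_zero_iff _).2 hϖ0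
  have hvϖpos : (0 : ℤᵐ⁰) < Valued.v ϖ := zero_lt_iff.2 hvϖ0
  have hπ : Valued.v (jE ϖ) = exp (-1 : ℤ) := by rw [hjiso, hϖ]
  have hπn : ∀ n : ℕ, Valued.v (jE ϖ) ^ n = exp (-(n : ℤ)) := fun n => by rw [hπ, ← exp_nsmul, nsmul_eq_mul, mul_neg, mul_one]
  have hϖn : ∀ n : ℕ, Valued.v ϖ ^ n = exp (-(n : ℤ)) := fun n => by rw [hϖ, ← exp_nsmul, nsmul_eq_mul, mul_neg, mul_one]
  have hm3 : mstarOfRecord 2 = 3 := by norm_num [mstarOfRecord]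
  have hmc4 : mcOfRecord 2 = 4 := by norm_num [mcOfRecord, mstarOfRecord]
  have hdt : 2 ≤ tE := d_le_t_of_even hD (by norm_num)
  have h2v : Valued.v (2 : E) < 1 := by rw [h2t]; exact pow_lt_one₀ zero_le hϖlt (by omega)
  have hhW0 : hW ≠ 0 := fun h0 => by rw [h0, map_zero] at hhW; exact zero_ne_one hhW
  have hfE0 : fE ≠ 0 := fun h0 => by rw [h0, map_zero] at hfE1; exact zero_ne_one hfE1
  have hA0 : α - ρ α ≠ 0 := sub_ne_zero.2 (Ne.symm hα)
  have hq1 : 1 ≤ Nat.card 𝓀[E] := Nat.card_pos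
  -- the K6 floor: `m ≥ N 2 tE q ≥ 8`, so `b ≥ 4`
  have hN8 := hN 2 tE (Nat.card 𝓀[E])
  have hb4 : 4 ≤ b := by omega
  -- the flip cell: `jl = 2b + c + 2`, `c` even (★ `antiDepth_mod_two_eq`), `c ≥ 4`
  have hμρ : Valued.v ((lam - jE ((u : Matrix (Fin 1) (Fin 1) E) 0 0)) - ρ (lam - jE ((u : Matrix (Fin 1) (Fin 1) E) 0 0))) = Valued.v (jE ϖ) ^ jl := by
    rw [hjl, hπn]
  have hlamρ : lam - ρ lam = (lam - jE ((u : Matrix (Fin 1) (Fin 1) E) 0 0)) - ρ (lam - jE ((u : Matrix (Fin 1) (Fin 1) E) 0 0)) := by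
    rw [map_sub, hρj]; ring
  have hjlpar : jl % 2 = 2 % 2 := antiDepth_mod_two_eq jE hΘρ hDM hΘlam hvlam hvρ (by rw [hlamρ, hjl]) (by omega)
  obtain ⟨n₀, hn₀⟩ : ∃ n₀ : ℕ, c = 2 * n₀ := ⟨c / 2, by omega⟩
  -- the chart (★ LH4-p19): `Tr_ρ κ₀ = 1`, `|κ₀| ≤ 1`, `ρξ₀ = −ξ₀ ≠ 0`, `|ξ₀| = exp c`
  obtain ⟨κ₀, ξ₀, hκ₀, hΘκ₀, hξ, hΘξ, hξ0, hκ₀1, hξ₀v⟩ := exists_refPair_of_frame hD jE hjiso hjfix hΘj hρρ hvρ hΘρ hα1 hU hDM hq hσres hτ n₀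
  have hξc : Valued.v ξ₀ = exp (c : ℤ) := by rw [hξ₀v, hn₀]; push_cast; ring_nf
  have hξ1 : 1 ≤ Valued.v ξ₀ := by rw [hξc, ← exp_zero, exp_le_exp]; omega
  have hκξ : Valued.v κ₀ < Valued.v ξ₀ := lt_of_le_of_lt hκ₀1 (by rw [hξc, ← exp_zero, exp_lt_exp]; omega)
  -- the class letters of the frame (★ LH4-p19)
  have hFgap := fgap_of_datum (ρ := ρ) hDM
  have hdeep := deep_of_datum (ρ := ρ) hD jE hjv hjfix hΘj (n := 2 * 2) (by norm_num)
  obtain ⟨c₀, -, hc₀1, -, hdich⟩ := dich_of_datum hDM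
  have hwit := exists_flipWitness_of_frame hD jE hjiso hjfix hΘj hρρ hvρ hΘρ hα1 hU hDM hq hσres hτ
  -- the `(1, α)`-coordinates of `μ = lam − jE u₀₀`, and `R₀`, `γ₀`, through `Fix ρ = jE(E)`
  obtain ⟨μb, hμb⟩ : ∃ μb : E, jE μb = ((lam - jE ((u : Matrix (Fin 1) (Fin 1) E) 0 0)) - ρ (lam - jE ((u : Matrix (Fin 1) (Fin 1) E) 0 0))) / (α - ρ α) :=
    (hjfix _).1 (by
      rw [map_div₀, div_eq_div_iff ((map_ne_zero ρ).2 hA0) hA0]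
      simp only [map_sub, hρρ, hρj]
      ring)
  obtain ⟨μa, hμa⟩ : ∃ μa : E, jE μa = (lam - jE ((u : Matrix (Fin 1) (Fin 1) E) 0 0)) - jE μb * α :=
    (hjfix _).1 (by
      rw [map_sub ρ (lam - jE ((u : Matrix (Fin 1) (Fin 1) E) 0 0)), map_mul, hρj, hμb]
      field_simp
      simp only [map_sub, hρj]
      ring)
  have hμab : lam - jE ((u : Matrix (Fin 1) (Fin 1) E) 0 0) = jE μa + jE μb * α := by rw [hμa]; ring
  obtain ⟨R₀, hR₀⟩ : ∃ R₀ : E, jE R₀ = α * κ₀ + ρ (α * κ₀) := (hjfix _).1 (by rw [map_add, hρρ, add_comm])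
  obtain ⟨γ₀, hγ₀⟩ : ∃ γ₀ : E, jE γ₀ = ξ₀ * (α - ρ α) := (hjfix _).1 (by rw [map_mul, hξ, map_sub, hρρ]; ring)
  -- sizes: `|jE μb| = |jEϖ|^jl`, `|μ_a + μ_b R₀| = |ϖ|^(2b)`, `|μ_b γ₀| = |ϖ|^(2b+2)`, `|P| = |ϖ|^(2b)`
  have hμbv : Valued.v (jE μb) = Valued.v (jE ϖ) ^ jl := by rw [hμb, map_div₀, hμρ, hU, div_one]
  have hμ2b : Valued.v (lam - jE ((u : Matrix (Fin 1) (Fin 1) E) 0 0)) = Valued.v (jE ϖ) ^ (2 * b) := by rw [hm, hπn, hb2]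
  have hμav : Valued.v (jE μa) = Valued.v (jE ϖ) ^ (2 * b) := by
    have hlt : Valued.v (jE μb * α) < Valued.v (lam - jE ((u : Matrix (Fin 1) (Fin 1) E) 0 0)) := by
      rw [Valuation.map_mul, hμbv, hμ2b]
      calc Valued.v (jE ϖ) ^ jl * Valued.v α ≤ Valued.v (jE ϖ) ^ jl * 1 := mul_le_mul' le_rfl hα1
        _ < Valued.v (jE ϖ) ^ (2 * b) := by rw [mul_one]; exact pow_lt_pow_right_of_lt_one₀ hvjϖpos hjϖlt (by omega)
    rw [hμa, Valuation.map_sub_eq_of_lt_left _ hlt, hμ2b]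
  have hR₀v : Valued.v (jE R₀) ≤ 1 := by
    rw [hR₀]
    refine (Valuation.map_add _ _ _).trans (max_le ?_ ?_)
    · rw [Valuation.map_mul]; exact mul_le_one' hα1 hκ₀1
    · rw [hvρ, Valuation.map_mul]; exact mul_le_one' hα1 hκ₀1
  have hPv : Valued.v ((ϖ * σ ϖ) ^ b) = Valued.v ϖ ^ (2 * b) := by rw [Valuation.map_pow, Valuation.map_mul, hvσ, ← pow_two, ← pow_mul]
  have hP0 : (ϖ * σ ϖ) ^ b ≠ 0 := pow_ne_zero _ (mul_ne_zero hϖ0 ((map_ne_zero σ).2 hϖ0))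
  have hâ0 : Valued.v (μa + μb * R₀) = Valued.v ϖ ^ (2 * b) := by
    rw [← hjiso, map_add, map_mul]
    have hlt : Valued.v (jE μb * jE R₀) < Valued.v (jE μa) := by
      rw [Valuation.map_mul, hμbv, hμav]
      calc Valued.v (jE ϖ) ^ jl * Valued.v (jE R₀) ≤ Valued.v (jE ϖ) ^ jl * 1 := mul_le_mul' le_rfl hR₀v
        _ < Valued.v (jE ϖ) ^ (2 * b) := by rw [mul_one]; exact pow_lt_pow_right_of_lt_one₀ hvjϖpos hjϖlt (by omega)
    rw [Valuation.map_add_eq_of_lt_left _ hlt, hμav, hjiso]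
  have hâ : Valued.v ((μa + μb * R₀) * ((ϖ * σ ϖ) ^ b)⁻¹) = 1 := by
    rw [Valuation.map_mul, map_inv₀, hâ0, hPv, mul_inv_cancel₀ (pow_ne_zero _ hvϖ0)]
  have hμbγ₀ : Valued.v (μb * γ₀) = Valued.v ϖ ^ (2 * b + 2) := by
    rw [← hjiso, map_mul, Valuation.map_mul, hμbv, hγ₀, Valuation.map_mul, hU, mul_one, hξc, hπn, ← exp_add, hϖn]
    congr 1; push_cast; omega
  have hbh : Valued.v (μb * γ₀ * ((ϖ * σ ϖ) ^ b)⁻¹) = Valued.v ϖ ^ (2 * 1) := by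
    rw [Valuation.map_mul, map_inv₀, hμbγ₀, hPv, hϖn, hϖn, hϖn, ← exp_neg, ← exp_add]
    congr 1; push_cast; omega
  -- the label dictionary (★ p862927) at `g = 1`
  obtain ⟨α₁, γ₁, hα₁σ, hα₁1, hγ₁σ, hγ₁v, haff⟩ := exists_affineLabel_of_coords hD (by norm_num) hâ hbh le_rfl
  have hγ₁lt : Valued.v γ₁ < 1 := by rw [hγ₁v]; exact pow_lt_one₀ zero_le hϖlt (by norm_num)
  have hγ₁2 : Valued.v γ₁ = Valued.v ϖ ^ 2 := by rw [hγ₁v]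
  -- the digit system: fixed integral digits modulo `|ϖ|^4` (★ `exists_repr_fixedBall_card`)
  obtain ⟨Rd, hRd1, hRd2, hRd3, -⟩ := exists_repr_fixedBall_card hσσ hvσ hfix hϖ hdϖ 4 0
  simp only [mul_zero, pow_zero, add_zero] at hRd1 hRd2 hRd3
  have hRdσ : ∀ V ∈ Rd, σ V = V := fun V hV => (hRd1 V hV).1
  -- the precision letters at the flip cell (`|ξ₀|·|cc(α−ρα)| = |jEϖ|^b`)
  obtain ⟨hccv, hbv⟩ := radius_letters jE hjiso hϖ hU j b
  have hccA : jE ϖ ^ j * (α - ρ α) ≠ 0 := mul_ne_zero (pow_ne_zero _ hjϖ0) hA0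
  have hR1 : Valued.v ξ₀ * Valued.v (jE ϖ ^ j * (α - ρ α)) = Valued.v (jE ϖ) ^ b := by
    rw [hξc, hccv, hbv, ← exp_add]; congr 1; omega
  have hrprod : Valued.v ϖ ^ 4 * Valued.v ξ₀ * Valued.v (jE ϖ ^ j * (α - ρ α)) = exp (-(4 + (b : ℤ))) := by
    rw [mul_assoc, hR1, hϖn, hbv, ← exp_add]; congr 1; push_cast; ring
  have hrfloor : Valued.v (jE ϖ) ^ (2 * b) ≤ Valued.v ϖ ^ 4 * Valued.v ξ₀ * Valued.v (jE ϖ ^ j * (α - ρ α)) := by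
    rw [hrprod, hπn, exp_le_exp]; push_cast; omega
  have hrR : Valued.v ϖ ^ 4 * Valued.v ξ₀ * Valued.v (jE ϖ ^ j * (α - ρ α)) < Valued.v (jE ϖ) ^ b := by
    rw [hrprod, hbv, exp_lt_exp]; omega
  have hr₀ : Valued.v ϖ ^ 4 * Valued.v ξ₀ * Valued.v (jE ϖ ^ j * (α - ρ α)) ≤ Valued.v (jE ϖ) ^ (2 * 2) * Valued.v (jE ϖ) ^ b := by
    rw [hrprod, hπn, hbv, ← exp_add, exp_le_exp]; push_cast; omega
  have hrγ : Valued.v γ₁ * Valued.v ϖ ^ 4 ≤ Valued.v ϖ ^ (2 * 2 - 1) := by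
    rw [hγ₁2, ← pow_add]; exact pow_le_pow_right_of_le_one' hϖ1 (by norm_num)
  have hξv : Valued.v ξ₀ * Valued.v (jE ϖ) ^ jl = Valued.v (jE ϖ) ^ (2 * b + 2 * 1) := by
    rw [hξc, hπn, hπn, ← exp_add]; congr 1; push_cast; omega
  -- the fences at `m_c = 4 ≤ N 2 tE q`
  have hlamn : Valued.v (lam - 1) ≤ Valued.v (jE ϖ) ^ mcOfRecord 2 := by
    rw [hmc4]; rw [Valuation.map_pow] at hlam1; exact hlam1.trans (pow_le_pow_right_of_le_one' hjϖle (by omega))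
  have hun : Valued.v ((u : Matrix (Fin 1) (Fin 1) E) 0 0 - 1) ≤ Valued.v ϖ ^ mcOfRecord 2 := by
    rw [hmc4]; rw [Valuation.map_pow] at hu1N; exact hu1N.trans (pow_le_pow_right_of_le_one' hϖ1 (by omega))
  have hmcm : mcOfRecord 2 ≤ m := by rw [hmc4]; omega
  have hjm : j + mstarOfRecord 2 ≤ jl := by rw [hm3]; omega
  -- ★ F1b at the flip cell (`g = 1`)
  have hI := rowTower_cellDiff_mul_card_eq σ ϖ 2 tE hD jE ρ Θ α lam hρρ hvρ hjv hjfix hΘj hΘΘ hΘρ hvΘ hα hα1 hint hvlam hU hjiso hjpow hϖmax γ₂ u m jl hm hjl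
    hum H₂ hW hH₂ hH₂σ hhW hhWσ φ h hφs hφi hφo hφγ hform hΘh hh f hf hfinLS b hb2 (by norm_num) hΘlam P₁ hA hΓ hmcm hlamn hun hFgap hdeep hc₀1 hdich hwit
    (show b ≤ j by omega) hjm hκ₀ hΘκ₀ hκ₀1 hξ hΘξ (le_refl 1) (show j + b + 2 * 1 ≤ jl by omega) hξv hμab hR₀ hγ₀ hα₁σ hα₁1 hγ₁σ hγ₁lt haff Rd hRdσ hRd2
    hRd3 hrfloor hrR hr₀ hdeep hrγ
  -- the digit reads of the flip cell: sphere ↔ unit (★ p864361), far shell (`c ≥ 4`)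
  have hsph : ∀ V : E, Valued.v V ≤ 1 →
      (Valued.v (κ₀ + jE V * ξ₀) * Valued.v (jE ϖ ^ j * (α - ρ α)) = Valued.v (jE ϖ) ^ b ↔ Valued.v V = 1) := fun V hV =>
    sphereClause_iff_v_eq_one_of_lt jE hjiso hccA hκξ hR1 hV
  have hfar : 1 ≤ Valued.v (jE ϖ) ^ (2 * 2 - 1) * Valued.v ξ₀ := by
    rw [hπn, hξc, ← exp_add, ← exp_zero, exp_le_exp]; push_cast; omega
  by_cases hL : Rd.filter (fun V₀ : E => Valued.v (κ₀ + jE V₀ * ξ₀) * Valued.v (jE ϖ ^ j * (α - ρ α)) = Valued.v (jE ϖ) ^ b ∧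
        ∃ e : M, ρ e = e ∧ e * Θ e = (κ₀ + jE V₀ * ξ₀) * ρ (κ₀ + jE V₀ * ξ₀) / (h * ρ h)) = ∅
  · -- `Rd.filter LIT = ∅`: the cell is EMPTY — the digit of a member would be a LIT digit ((hV) ★ p863914, `hRd2`, (hLit) ★ p863983)
    have hcellEq : levelSetDep ρ Θ α (jE ϖ) h j b (lam - jE ((u : Matrix (Fin 1) (Fin 1) E) 0 0)) = levelSet ρ Θ α (jE ϖ) h j b :=
      levelSetDep_eq_levelSet_of_add_le hρρ hvρ hΘΘ hΘρ hvΘ hα1 hU (hρj ϖ) hπ hh hm hjl hb1 (by omega) (by omega)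
    have hempty : levelSetDep ρ Θ α (jE ϖ) h j b (lam - jE ((u : Matrix (Fin 1) (Fin 1) E) 0 0)) = ∅ := by
      rw [hcellEq]
      refine Set.subset_empty_iff.1 fun Λ hΛ => ?_
      obtain ⟨x₀, hG⟩ := (mem_levelSet_iff ρ Θ α (jE ϖ) h j b Λ).1 hΛ
      obtain ⟨Ve, hjVe, hσVe, hVe1⟩ :=
        exists_coord_of_gen hD jE hjv hjfix hΘj hρρ hvρ hΘΘ hΘρ hΘh hb1 hccA hFgap hκ₀ hΘκ₀ hξ hΘξ hξ0 (hκ₀1.trans hξ1) hR1.ge Λ x₀ hG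
      obtain ⟨V₀, hV₀R, hV₀n⟩ := hRd2 Ve hσVe hVe1
      have hlit := lit_of_near_of_gen hD jE hjv hjfix hΘj hρρ hvρ hΘΘ hΘρ hΘh hh hb1 hccA hFgap hκ₀ hΘκ₀ hξ hΘξ hξ0 hrR hr₀ hdeep Λ x₀ hG V₀
        (hRdσ V₀ hV₀R) (by rw [← hjVe, ← map_sub, hjiso]; exact hV₀n)
      have hmem : V₀ ∈ Rd.filter (fun V₀ : E => Valued.v (κ₀ + jE V₀ * ξ₀) * Valued.v (jE ϖ ^ j * (α - ρ α)) = Valued.v (jE ϖ) ^ b ∧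
        ∃ e : M, ρ e = e ∧ e * Θ e = (κ₀ + jE V₀ * ξ₀) * ρ (κ₀ + jE V₀ * ξ₀) / (h * ρ h)) := Finset.mem_filter.2 ⟨hV₀R, hlit⟩
      rw [hL] at hmem
      simp at hmem
    rw [hempty]
    simp only [Set.empty_inter, finsum_mem_empty, Nat.cast_zero, sub_self, mul_zero, neg_zero]
  · -- `Rd.filter LIT ≠ ∅`: it is the unit shell (★ F2a §1), and ★ F2a §2 evaluates `#` and `Σ`
    obtain ⟨V₁, hV₁⟩ := Finset.nonempty_iff_ne_empty.2 hL
    obtain ⟨hV₁R, hsph₁, hcls₁⟩ := Finset.mem_filter.1 hV₁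
    have hV₁1 : Valued.v V₁ = 1 := (hsph V₁ (hRd1 V₁ hV₁R).2).1 hsph₁
    have hLU : Rd.filter (fun V₀ : E => Valued.v (κ₀ + jE V₀ * ξ₀) * Valued.v (jE ϖ ^ j * (α - ρ α)) = Valued.v (jE ϖ) ^ b ∧
        ∃ e : M, ρ e = e ∧ e * Θ e = (κ₀ + jE V₀ * ξ₀) * ρ (κ₀ + jE V₀ * ξ₀) / (h * ρ h)) = Rd.filter (fun V => Valued.v V = 1) := by
      refine Finset.filter_congr fun V hV => ?_
      refine ⟨fun hl => (hsph V (hRd1 V hV).2).1 hl.1, fun hV1 => ⟨(hsph V (hRd1 V hV).2).2 hV1, ?_⟩⟩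
      exact (classClause_iff_of_units_far hD jE hjfix hΘj hjiso hρρ hvρ hΘρ (h * ρ h) hΘκ₀ hκ₀1 hΘξ hfar (hRd1 V hV).1 hV1 (hRd1 V₁ hV₁R).1 hV₁1).2
        hcls₁
    obtain ⟨hcardU, hsumU⟩ := card_unitDigits_and_sum_normSign_affine hD h2v hα₁σ hα₁1 hγ₁σ hγ₁2 Rd hRd1 hRd2 hRd3
    rw [Finset.filter_true_of_mem (fun _ _ => trivial), hLU, hcardU, hsumU, Nat.cast_mul, Nat.cast_sub hq1, Nat.cast_one] at hI
    -- SIGN RECONCILIATION: `haff` at `(T, V, f) := (1, 0, −fE)` from the row's clean `M`-letter `hμf`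
    have hrec : normSign σ (-fE) = normSign σ α₁ := by
      have hS : Valued.v (μa + μb * R₀ + fE * ((ϖ - σ ϖ) * ((ϖ * σ ϖ) ^ ((2 - 2 % 2) / 2))⁻¹) * (ϖ * σ ϖ) ^ b) ≤ Valued.v ϖ ^ (2 * b + 3) := by
        rw [← hjiso, map_add jE, map_add jE, map_mul jE μb R₀]
        have esplit : jE μa + jE μb * jE R₀ + jE (fE * ((ϖ - σ ϖ) * ((ϖ * σ ϖ) ^ ((2 - 2 % 2) / 2))⁻¹) * (ϖ * σ ϖ) ^ b) =
            (lam - jE ((u : Matrix (Fin 1) (Fin 1) E) 0 0) + jE (fE * ((ϖ - σ ϖ) * ((ϖ * σ ϖ) ^ ((2 - 2 % 2) / 2))⁻¹) * (ϖ * σ ϖ) ^ b)) +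
              jE μb * (jE R₀ - α) := by
          rw [hμa]; ring
        rw [esplit]
        refine (Valuation.map_add _ _ _).trans (max_le ?_ ?_)
        · calc _ ≤ Valued.v (jE ϖ) ^ (2 * b + mstarOfRecord 2) := hμf
            _ = Valued.v ϖ ^ (2 * b + 3) := by rw [hjiso, hm3]
        · rw [Valuation.map_mul, hμbv]
          calc Valued.v (jE ϖ) ^ jl * Valued.v (jE R₀ - α) ≤ Valued.v (jE ϖ) ^ jl * 1 :=
                mul_le_mul' le_rfl ((Valuation.map_sub _ _ _).trans (max_le hR₀v hα1))
            _ ≤ Valued.v ϖ ^ (2 * b + 3) := by rw [mul_one, hjiso]; exact pow_le_pow_right_of_le_one' hϖ1 (by omega)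
      have hest : Valued.v (1 * ((μa + μb * R₀) * ((ϖ * σ ϖ) ^ b)⁻¹ + μb * γ₀ * ((ϖ * σ ϖ) ^ b)⁻¹ * 0) -
          (-fE) * ((ϖ - σ ϖ) * ((ϖ * σ ϖ) ^ ((2 - 2 % 2) / 2))⁻¹)) ≤ Valued.v ϖ ^ mstarOfRecord 2 := by
        have e : 1 * ((μa + μb * R₀) * ((ϖ * σ ϖ) ^ b)⁻¹ + μb * γ₀ * ((ϖ * σ ϖ) ^ b)⁻¹ * 0) - (-fE) * ((ϖ - σ ϖ) * ((ϖ * σ ϖ) ^ ((2 - 2 % 2) / 2))⁻¹) =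
            (μa + μb * R₀ + fE * ((ϖ - σ ϖ) * ((ϖ * σ ϖ) ^ ((2 - 2 % 2) / 2))⁻¹) * (ϖ * σ ϖ) ^ b) * ((ϖ * σ ϖ) ^ b)⁻¹ := by
          field_simp
          ring
        rw [e, Valuation.map_mul, map_inv₀, hPv, hm3]
        calc Valued.v (μa + μb * R₀ + fE * ((ϖ - σ ϖ) * ((ϖ * σ ϖ) ^ ((2 - 2 % 2) / 2))⁻¹) * (ϖ * σ ϖ) ^ b) * (Valued.v ϖ ^ (2 * b))⁻¹
            ≤ Valued.v ϖ ^ (2 * b + 3) * (Valued.v ϖ ^ (2 * b))⁻¹ := mul_le_mul' hS le_rfl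
          _ = Valued.v ϖ ^ 3 := by rw [pow_add, mul_comm (Valued.v ϖ ^ (2 * b)), mul_assoc, mul_inv_cancel₀ (pow_ne_zero _ hvϖ0), mul_one]
      have h1 := haff 1 0 (-fE) (map_one σ) (by rw [Valuation.map_one]) (map_zero σ) (by rw [Valuation.map_zero]; exact zero_le)
        (by rw [map_neg, hfE]) hest
      rw [h1, mul_zero, add_zero, normSign_of_isNorm σ ⟨1, by rw [map_one, mul_one]⟩, one_mul]
    have hωprod : normSign σ (-hW) * normSign σ α₁ = normSign σ (fE * hW) := by
      rw [← hrec, ← normSign_mul_of_fixed hD (by rw [map_neg, hhWσ]) (by rw [map_neg, hfE]) (neg_ne_zero.2 hhW0) (neg_ne_zero.2 hfE0),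
        show -hW * -fE = fE * hW by ring]
    have hsgn : (if ∃ z : E, z * σ z = fE * hW then (1 : ℤ) else -1) = normSign σ (fE * hW) := rfl
    rw [hsgn, ← hωprod]
    -- cancel `q` in ★ F1b's identity
    have hq0 : (Nat.card 𝓀[E] : ℤ) ≠ 0 := by exact_mod_cast (by omega : Nat.card 𝓀[E] ≠ 0)
    refine mul_left_cancel₀ hq0 ?_
    linear_combination hI

end Summit.HodgeConjecture.HodgeConjecture.Cruxes.H413.F0P3cDyRamFlipvalOfRowTowerCell

end
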